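import Literature.Analysis.FluidPDE.DuchonRobertPressure
import Literature.Analysis.FluidPDE.DuchonRobertCubicIdentity
import Literature.Analysis.FluidPDE.DuchonRobertSymmTestFieldProofs
import Literature.Analysis.FluidPDE.DuchonRobertMollifiedTransport
import Literature.Analysis.FluidPDE.DuchonRobertLocalBalancePressureProofs
import Literature.Analysis.FluidPDE.DuchonRobertLocalBalanceViscousProofs
import Literature.Analysis.FunctionSpaces.TorusRieszTransformProofs
import Literature.Analysis.FunctionSpaces.TorusRieszTransformDimension
import HarnessLib

/-!
# Duchon–Robert 2000, Prop. 4 (vanishing-viscosity limits dissipate through the defect): assembly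

Analysis/FluidPDE proof file; sibling of `DissipationAnomaly` (the named fact
`Torus.IsDissipationMeasureOf.hasDuchonRobertDefect`: J. Duchon, R. Robert, *Inertial energy
dissipation for weak solutions of incompressible Euler and Navier–Stokes equations*, Nonlinearity
13 (2000) 249–255, **Prop. 4** / (15), p. 253 — if Leray–Hopf solutions `u^ν → u` strongly in
`L³((0,T) × T^d)` along `ν → 0`, without viscous defect, then any dissipation measure `D` of the
sequence represents the Duchon–Robert defect of the limit, `∫ ψ dD = D(u)(ψ)`) and of
`DuchonRobertInviscidLimit` / `DuchonRobertLocalBalance` (the tree's reduction of Prop. 4 to its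
printed ingredients, `Torus.IsDissipationMeasureOf.hasDuchonRobertDefect_of_steps`).

All printed ingredients are now proved in the tree:

* (A1) the pressure of `L³` weak solutions and its `L^{3/2}` continuity,
  `Torus.exists_pressure_of_tendsto_L3_of` (`DuchonRobertPressure`; Robinson–Rodrigo–Sadowski 2016,
  Lemma 5.1 + Prop. 5.3), **modulo the Calderón–Zygmund fact on `T^d`**
  `Torus.eLpNorm_hessian_le_laplacian d` (RRS Thm. B.7), which the tree proves from the whole-space
  bound `stein1970_hessian_Lp_bound (EuclideanSpace ℝ d)` (`TorusRieszTransformProofs`), proves on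
  `ℝ³` (`stein1970_hessian_Lp_bound_holds_fin3`, `HessianLaplacianLpProofs`, by the Calderón–Zygmund
  theory of `Literature/Analysis/SingularIntegrals/`), whence on `𝕋³`
  (`Torus.eLpNorm_hessian_le_laplacian_holds_fin3`), and which descends along coordinate embeddings
  to every index type of cardinality `≤ 3` (`TorusRieszTransformDimension`,
  `Torus.eLpNorm_hessian_le_laplacian_of_card_le_three`); and now in **every** dimension
  (`Torus.eLpNorm_hessian_le_laplacian_holds`, `TorusRieszTransformProofs`, from
  `stein1970_hessian_Lp_bound_holds`, `HessianLaplacianLpGeneralProofs`: the Calderón–Zygmund theory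
  applied to the Riesz kernels of the heat semigroup on `ℝ^d`), so that (A1) is discharged outright
  (`exists_pressure_of_tendsto_L3_holds`);
* Duchon–Robert's Prop. 1–2 in five steps: `integral_kernelFlux_mul_eq_holds`
  (`DuchonRobertCubicIdentity`), `symmTestField_identity_holds` (`DuchonRobertSymmTestFieldProofs`),
  `tendsto_mollified_transport_holds` (`DuchonRobertMollifiedTransport`),
  `tendsto_pressure_pairing_holds` (`DuchonRobertLocalBalancePressureProofs`),
  `tendsto_viscous_pairing_holds` (`DuchonRobertLocalBalanceViscousProofs`).

Hence this file PROVES Duchon–Robert's Prop. 1–2 as stated in the tree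
(`Literature.Analysis.FluidPDE.duchon_robert_defect_exists`, `FluidPDE/DuchonRobert`: existence of
the defect distribution and the local energy balance for distributional solutions with
`u ∈ L³_{t,x}`, `p ∈ L^{3/2}_{t,x}`) UNCONDITIONALLY in every dimension
(`duchon_robert_defect_exists_holds`, the tree's assembly `Torus.duchon_robert_defect_exists_of` fed
with the five discharged steps), and Duchon–Robert's Prop. 4

* from the torus Calderón–Zygmund fact alone (`hasDuchonRobertDefect_of_CZ`), from the whole-space
  bound in dimension `d` (`hasDuchonRobertDefect_of_wholeSpace`), and
* **unconditionally on the physical torus `𝕋³`** (`hasDuchonRobertDefect_holds_fin3`), and more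
  generally for every index type of cardinality at most three
  (`hasDuchonRobertDefect_of_card_le_three`; `𝕋²`: `hasDuchonRobertDefect_holds_fin2`), and
* **unconditionally on `T^d` for every finite index type `d`**: the fully polymorphic discharges
  `exists_pressure_of_tendsto_L3_holds` and `IsDissipationMeasureOf.hasDuchonRobertDefect_holds`
  (from `Torus.eLpNorm_hessian_le_laplacian_holds`, i.e. the whole-space Calderón–Zygmund bound
  `stein1970_hessian_Lp_bound_holds` in dimension `d`, Stein 1970, III §1.3 Prop. 3).

## References

* J. Duchon, R. Robert, Nonlinearity 13 (2000) 249–255, Prop. 4 and its proof, p. 253; Prop. 1–2,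
  pp. 250–252. [DuchonRobert2000]
* J. C. Robinson, J. L. Rodrigo, W. Sadowski, *The Three-Dimensional Navier–Stokes Equations*,
  CUP 2016: Lemma 5.1, Prop. 5.3 (pp. 88–90); App. B Thm. B.7 (pp. 385–386).
  [RobinsonRodrigoSadowskiCUP2016]
* E. M. Stein, *Singular integrals and differentiability properties of functions* (1970), Ch. III
  §1.3 Prop. 3. [Stein1971]
-/

noncomputable section

open MeasureTheory Set Filter Topology Function

namespace Literature.Analysis.FluidPDE.Torus

section Assembly

variable {d : Type*} [Fintype d] {T : ℝ} {u : ℝ → UnitAddTorus d → EuclideanSpace ℝ d}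

/-- **(A1) from the whole-space Calderón–Zygmund bound in dimension `d`**: the pressure fact
`Torus.exists_pressure_of_tendsto_L3` follows from Stein's Prop. 3 on `ℝ^d`
(`Torus.exists_pressure_of_tendsto_L3_of` with `Torus.eLpNorm_hessian_le_laplacian_of_wholeSpace`).
[cite: DuchonRobert2000, proof of Prop. 1 (pp. 250–251)] -/
theorem exists_pressure_of_tendsto_L3_of_wholeSpace
    (h : stein1970_hessian_Lp_bound (EuclideanSpace ℝ d)) :
    exists_pressure_of_tendsto_L3 (T := T) (u := u) :=
  exists_pressure_of_tendsto_L3_of (FunctionSpaces.Torus.eLpNorm_hessian_le_laplacian_of_wholeSpace h)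

/-- **(A1) on the three-dimensional torus, unconditionally.**
[cite: DuchonRobert2000, proof of Prop. 1 (pp. 250–251)] -/
theorem exists_pressure_of_tendsto_L3_holds_fin3 {T : ℝ}
    {u : ℝ → UnitAddTorus (Fin 3) → EuclideanSpace ℝ (Fin 3)} :
    exists_pressure_of_tendsto_L3 (T := T) (u := u) :=
  exists_pressure_of_tendsto_L3_of FunctionSpaces.Torus.eLpNorm_hessian_le_laplacian_holds_fin3

/-- **Duchon–Robert 2000, Prop. 4, from the torus Calderón–Zygmund fact alone**: all other
ingredients of the tree's reduction `hasDuchonRobertDefect_of_steps` are proved.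
[cite: DuchonRobert2000, Prop. 4 and its proof p. 253] -/
theorem IsDissipationMeasureOf.hasDuchonRobertDefect_of_CZ
    (hCZ : FunctionSpaces.Torus.eLpNorm_hessian_le_laplacian d) :
    IsDissipationMeasureOf.hasDuchonRobertDefect (T := T) (u := u) :=
  IsDissipationMeasureOf.hasDuchonRobertDefect_of_steps (exists_pressure_of_tendsto_L3_of hCZ)
    (fun {_} => integral_kernelFlux_mul_eq_holds) (fun {_} => symmTestField_identity_holds)
    (fun {_} => tendsto_mollified_transport_holds) (fun {_} => tendsto_pressure_pairing_holds)
    (fun {_} => tendsto_viscous_pairing_holds)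

/-- **Duchon–Robert 2000, Prop. 4, from the whole-space Calderón–Zygmund bound in dimension `d`**
(Stein 1970, III §1.3 Prop. 3 on `ℝ^d`). [cite: DuchonRobert2000, Prop. 4 and its proof p. 253] -/
theorem IsDissipationMeasureOf.hasDuchonRobertDefect_of_wholeSpace
    (h : stein1970_hessian_Lp_bound (EuclideanSpace ℝ d)) :
    IsDissipationMeasureOf.hasDuchonRobertDefect (T := T) (u := u) :=
  IsDissipationMeasureOf.hasDuchonRobertDefect_of_CZ
    (FunctionSpaces.Torus.eLpNorm_hessian_le_laplacian_of_wholeSpace h)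

/-- **Duchon–Robert 2000, Prop. 4 on the three-dimensional torus `𝕋³`, proved** — the physical
case of the printed statement. [cite: DuchonRobert2000, Prop. 4 and its proof p. 253] -/
theorem IsDissipationMeasureOf.hasDuchonRobertDefect_holds_fin3 {T : ℝ}
    {u : ℝ → UnitAddTorus (Fin 3) → EuclideanSpace ℝ (Fin 3)} :
    IsDissipationMeasureOf.hasDuchonRobertDefect (T := T) (u := u) :=
  IsDissipationMeasureOf.hasDuchonRobertDefect_of_CZ
    FunctionSpaces.Torus.eLpNorm_hessian_le_laplacian_holds_fin3

/-! ### Tori of dimension at most three -/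

/-- **(A1) on tori of dimension at most three, unconditionally** (`𝕋¹`, `𝕋²`, `𝕋³` and every
finite index type of cardinality `≤ 3`). [cite: DuchonRobert2000, proof of Prop. 1 (pp. 250–251)] -/
theorem exists_pressure_of_tendsto_L3_of_card_le_three (hcard : Fintype.card d ≤ 3) :
    exists_pressure_of_tendsto_L3 (T := T) (u := u) :=
  exists_pressure_of_tendsto_L3_of (FunctionSpaces.Torus.eLpNorm_hessian_le_laplacian_of_card_le_three hcard)

/-- **Duchon–Robert 2000, Prop. 4 on tori of dimension at most three, proved** (every finite index
type of cardinality `≤ 3`). [cite: DuchonRobert2000, Prop. 4 and its proof p. 253] -/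
theorem IsDissipationMeasureOf.hasDuchonRobertDefect_of_card_le_three (hcard : Fintype.card d ≤ 3) :
    IsDissipationMeasureOf.hasDuchonRobertDefect (T := T) (u := u) :=
  IsDissipationMeasureOf.hasDuchonRobertDefect_of_CZ
    (FunctionSpaces.Torus.eLpNorm_hessian_le_laplacian_of_card_le_three hcard)

/-- **Duchon–Robert 2000, Prop. 4 on the two-dimensional torus `𝕋²`, proved.**
[cite: DuchonRobert2000, Prop. 4 and its proof p. 253] -/
theorem IsDissipationMeasureOf.hasDuchonRobertDefect_holds_fin2 {T : ℝ}
    {u : ℝ → UnitAddTorus (Fin 2) → EuclideanSpace ℝ (Fin 2)} :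
    IsDissipationMeasureOf.hasDuchonRobertDefect (T := T) (u := u) :=
  IsDissipationMeasureOf.hasDuchonRobertDefect_of_card_le_three (by simp)

/-! ### Every dimension: the discharges -/

/-- **Discharge of the named fact `Torus.exists_pressure_of_tendsto_L3`** (Duchon–Robert 2000,
proof of Prop. 1, pp. 250–251: "the linear operator `uᵢuₖ → p` is strongly continuous on `L^q` for
`1 < q < ∞`, and so `p ∈ L^{3/2}(0,T;L^{3/2})`"; Robinson–Rodrigo–Sadowski 2016, Lemma 5.1 (5.7),
(5.9)–(5.10) and Prop. 5.3 (5.17), pp. 88–90), on `T^d` for **every** finite index type `d`: if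
`u_m` (eventually) and `u` are pressure-free weak solutions on `T^d × (0,T)` with `u ∈ L³_{t,x}` and
`u_m → u` in `L³_{t,x}`, there are pressures `p_m, p ∈ L^{3/2}_{t,x}` making `(u_m, p_m)`
(eventually) and `(u, p)` distributional solutions, with `p_m → p` in `L^{3/2}_{t,x}`. PROVED: the
tree's reduction `Torus.exists_pressure_of_tendsto_L3_of` (`DuchonRobertPressure`: the `L^{3/2}`
pressure of `TorusPressurePoisson`, the Helmholtz split of a general test field, and
`‖u_m ⊗ u_m − u ⊗ u‖_{3/2} ≤ (‖u_m‖₃ + ‖u‖₃)‖u_m − u‖₃`) fed with the Calderón–Zygmund bound on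
`T^d` in every dimension, `Torus.eLpNorm_hessian_le_laplacian_holds` (`TorusRieszTransformProofs`,
RRS Thm. B.7, from Stein 1970, III §1.3 Prop. 3 on `ℝ^d`, `stein1970_hessian_Lp_bound_holds`).
[cite: DuchonRobert2000, proof of Prop. 1 (pp. 250–251)]
[cite: RobinsonRodrigoSadowskiCUP2016, Lemma 5.1 and Prop. 5.3 (pp. 88–90)] -/
theorem exists_pressure_of_tendsto_L3_holds : exists_pressure_of_tendsto_L3 (T := T) (u := u) :=
  exists_pressure_of_tendsto_L3_of FunctionSpaces.Torus.eLpNorm_hessian_le_laplacian_holds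

/-- **Discharge of the named fact `Torus.IsDissipationMeasureOf.hasDuchonRobertDefect`**
(Duchon–Robert 2000, Prop. 4 and its proof, p. 253: if Leray–Hopf solutions `u^ν → u` strongly in
`L³((0,T) × T^d)` along `ν → 0⁺`, without viscous defect, then every dissipation measure `D` of
the sequence represents the Duchon–Robert defect of the limit, `∫ ψ dD = D(u)(ψ)`), on `T^d` for
**every** finite index type `d`: the tree's reduction `hasDuchonRobertDefect_of_CZ` (all printed
ingredients proved) fed with `Torus.eLpNorm_hessian_le_laplacian_holds`.
[cite: DuchonRobert2000, Prop. 4 and its proof p. 253] -/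
theorem IsDissipationMeasureOf.hasDuchonRobertDefect_holds :
    IsDissipationMeasureOf.hasDuchonRobertDefect (T := T) (u := u) :=
  IsDissipationMeasureOf.hasDuchonRobertDefect_of_CZ
    FunctionSpaces.Torus.eLpNorm_hessian_le_laplacian_holds

end Assembly

end Literature.Analysis.FluidPDE.Torus

namespace Literature.Analysis.FluidPDE

/-! ### Duchon–Robert's Prop. 1–2 (the defect and the local energy balance), unconditionally -/

section DefectExists

variable {d : Type*} [Fintype d] [DecidableEq d] {T ν : ℝ} {u : ℝ → UnitAddTorus d → EuclideanSpace ℝ d}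
  {p : ℝ → UnitAddTorus d → ℝ}

/-- **Discharge of `FluidPDE.duchon_robert_defect_exists`** (Duchon–Robert 2000, Prop. 1–2 and
(10)): for a distributional Navier–Stokes/Euler solution `(u, p)` on `T^d × (0,T)` with
`u ∈ L³_{t,x}`, `p ∈ L^{3/2}_{t,x}` (and `u ∈ L²_t H¹_x` if `ν ≠ 0`), the Duchon–Robert defect
`D(u)` exists, is independent of the mollifier, and the local energy balance holds — the tree's
assembly `Torus.duchon_robert_defect_exists_of` (`DuchonRobertLocalBalance`) fed with the five
discharged steps `integral_kernelFlux_mul_eq_holds`, `symmTestField_identity_holds`,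
`tendsto_mollified_transport_holds`, `tendsto_pressure_pairing_holds`,
`tendsto_viscous_pairing_holds`. No Calderón–Zygmund input is needed here (the pressure is a
datum). [cite: DuchonRobert2000, Prop. 1–2 and (10) (pp. 250–252)] -/
theorem duchon_robert_defect_exists_holds :
    duchon_robert_defect_exists (T := T) (ν := ν) (u := u) (p := p) :=
  Torus.duchon_robert_defect_exists_of Torus.integral_kernelFlux_mul_eq_holds
    Torus.symmTestField_identity_holds Torus.tendsto_mollified_transport_holds
    Torus.tendsto_pressure_pairing_holds Torus.tendsto_viscous_pairing_holds

end DefectExists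

end Literature.Analysis.FluidPDE
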